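import Mathlib

/-! # De-bordering by interpolation: stub `stub_evalSum` of line `Sketch` (eps-order-ladder) for crux `WordLengthQP` (stmt-ValiantsHypothesis-6623)

Setting: border width-2 programs over `R = MvPolynomial σ (Polynomial ℂ)` (`ε = Polynomial.X` in
the coefficient ring `Polynomial ℂ`; the `x̄`-variables are `MvPolynomial.X v`), whose letters are
`2 × 2` matrices with S-affine entries `C b` or `C a * X v + C b` (`a b : Polynomial ℂ`).

**Statement** (`stub_evalSum`, step 3 of the converse transfer `X → EpsOrderLadder`): if every
`ℂ[ε]`-coefficient `a`, `b` of the at most `L` letters `ms` has `ε`-degree `≤ q`, the `(0,0)`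
entry `F` of their product satisfies the border equation `F = ε^q · f + ε^(q+1) · G`, and
`x c : Fin N → ℂ` are moment weights with `Σᵢ cᵢ xᵢ^k = [k = q]` for all `k ≤ D`, where
`L q ≤ D` and `q ≤ D`, then `f = Σᵢ cᵢ • (Πₘ φᵢ(m)) 0 0` with `φᵢ` the evaluation `ε ↦ xᵢ`
(`MvPolynomial.map (Polynomial.evalRingHom (x i))`, applied entrywise to each letter).

**Proof**: coefficientwise in `x̄`.  Every `ℂ[ε]`-coefficient of `F` has `ε`-degree
`≤ ms.length · q ≤ L q ≤ D` (induction on the word), so for each monomial `mono`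
`Σᵢ cᵢ · (coeff mono F)(xᵢ) = Σ_{k ≤ D} (coeff mono F)ₖ · Σᵢ cᵢ xᵢ^k = (coeff mono F)_q`, which is
`coeff mono f` by the border equation; and `φᵢ` is a ring hom, so `φᵢ.mapMatrix` is
multiplicative and `(Πₘ φᵢ(m)) 0 0 = φᵢ(F)`.  Mathlib only. -/

-- `Summit.ValiantsHypothesis.ValiantsHypothesis.…` is the tree's mandated single-conjunct layout
-- (Sub = Summit), so the duplicated namespace component is intended.
set_option linter.dupNamespace false

noncomputable section

open MvPolynomial

namespace Summit.ValiantsHypothesis.ValiantsHypothesis.Cruxes.WordLengthQP.EpsOrderLadder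

/-- Coefficientwise `ε`-degree of a product: if all `x̄`-coefficients of `g₁` (resp. `g₂`) have
`ε`-degree `≤ d₁` (resp. `≤ d₂`), those of `g₁ * g₂` have `ε`-degree `≤ d₁ + d₂`. -/
theorem evalSum_natDegree_coeff_mul {σ : Type} {g₁ g₂ : MvPolynomial σ (Polynomial ℂ)}
    {d₁ d₂ : ℕ} (h₁ : ∀ mono, (MvPolynomial.coeff mono g₁).natDegree ≤ d₁)
    (h₂ : ∀ mono, (MvPolynomial.coeff mono g₂).natDegree ≤ d₂) :
    ∀ mono, (MvPolynomial.coeff mono (g₁ * g₂)).natDegree ≤ d₁ + d₂ := by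
  classical
  intro mono
  rw [MvPolynomial.coeff_mul]
  refine Polynomial.natDegree_sum_le_of_forall_le _ _ (fun p _ => ?_)
  exact Polynomial.natDegree_mul_le.trans (Nat.add_le_add (h₁ _) (h₂ _))

/-- Coefficientwise `ε`-degree of a sum: if all `x̄`-coefficients of `g₁` and of `g₂` have
`ε`-degree `≤ d`, so do those of `g₁ + g₂`. -/
theorem evalSum_natDegree_coeff_add {σ : Type} {g₁ g₂ : MvPolynomial σ (Polynomial ℂ)}
    {d : ℕ} (h₁ : ∀ mono, (MvPolynomial.coeff mono g₁).natDegree ≤ d)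
    (h₂ : ∀ mono, (MvPolynomial.coeff mono g₂).natDegree ≤ d) :
    ∀ mono, (MvPolynomial.coeff mono (g₁ + g₂)).natDegree ≤ d := by
  intro mono
  rw [MvPolynomial.coeff_add]
  exact (Polynomial.natDegree_add_le _ _).trans (max_le (h₁ _) (h₂ _))

/-- An S-affine letter entry `C b` or `C a * X v + C b` with `natDegree a, natDegree b ≤ q` has all
its `x̄`-coefficients of `ε`-degree `≤ q`. -/
theorem evalSum_natDegree_coeff_letter {σ : Type} {q : ℕ} {p : MvPolynomial σ (Polynomial ℂ)}
    (hp : (∃ b : Polynomial ℂ, b.natDegree ≤ q ∧ p = MvPolynomial.C b) ∨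
      (∃ (a b : Polynomial ℂ) (v : σ), a.natDegree ≤ q ∧ b.natDegree ≤ q ∧
        p = MvPolynomial.C a * MvPolynomial.X v + MvPolynomial.C b)) :
    ∀ mono, (MvPolynomial.coeff mono p).natDegree ≤ q := by
  classical
  have hC : ∀ b : Polynomial ℂ, b.natDegree ≤ q → ∀ mono,
      (MvPolynomial.coeff mono (MvPolynomial.C b : MvPolynomial σ (Polynomial ℂ))).natDegree
        ≤ q := by
    intro b hb mono
    rw [MvPolynomial.coeff_C]
    split_ifs
    · exact hb
    · exact Polynomial.natDegree_zero.trans_le (Nat.zero_le q)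
  rcases hp with ⟨b, hb, rfl⟩ | ⟨a, b, v, ha, hb, rfl⟩
  · exact hC b hb
  · refine evalSum_natDegree_coeff_add (fun mono => ?_) (hC b hb)
    rw [MvPolynomial.coeff_C_mul, MvPolynomial.coeff_X]
    split_ifs
    · rw [mul_one]
      exact ha
    · rw [mul_zero]
      exact Polynomial.natDegree_zero.trans_le (Nat.zero_le q)

/-- Entries of a product of letters whose entries have `x̄`-coefficients of `ε`-degree `≤ q` have
`x̄`-coefficients of `ε`-degree `≤ ms.length * q`. -/
theorem evalSum_natDegree_coeff_prod {σ : Type} (q : ℕ)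
    (ms : List (Matrix (Fin 2) (Fin 2) (MvPolynomial σ (Polynomial ℂ))))
    (hS : ∀ m ∈ ms, ∀ i j : Fin 2, ∀ mono,
      (MvPolynomial.coeff mono (m i j)).natDegree ≤ q) :
    ∀ i j : Fin 2, ∀ mono,
      (MvPolynomial.coeff mono (ms.prod i j)).natDegree ≤ ms.length * q := by
  classical
  induction ms with
  | nil =>
    intro i j mono
    rw [List.prod_nil, List.length_nil, Nat.zero_mul, Matrix.one_apply, Nat.le_zero]
    split_ifs
    · rw [MvPolynomial.coeff_one]
      split_ifs
      · exact Polynomial.natDegree_one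
      · exact Polynomial.natDegree_zero
    · rw [MvPolynomial.coeff_zero]
      exact Polynomial.natDegree_zero
  | cons m ms ih =>
    intro i j mono
    have hm : ∀ i j : Fin 2, ∀ mono, (MvPolynomial.coeff mono (m i j)).natDegree ≤ q :=
      hS m List.mem_cons_self
    have ih' := ih (fun m' hm' => hS m' (List.mem_cons_of_mem _ hm'))
    have key : ∀ mono, (MvPolynomial.coeff mono
        (m i 0 * ms.prod 0 j + m i 1 * ms.prod 1 j)).natDegree ≤ q + ms.length * q :=
      evalSum_natDegree_coeff_add (evalSum_natDegree_coeff_mul (hm i 0) (ih' 0 j))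
        (evalSum_natDegree_coeff_mul (hm i 1) (ih' 1 j))
    calc (MvPolynomial.coeff mono ((m :: ms).prod i j)).natDegree
        = (MvPolynomial.coeff mono (m i 0 * ms.prod 0 j + m i 1 * ms.prod 1 j)).natDegree := by
          rw [List.prod_cons, Matrix.mul_apply, Fin.sum_univ_two]
      _ ≤ q + ms.length * q := key mono
      _ = (m :: ms).length * q := by rw [List.length_cons]; ring

/-- Evaluation `ε ↦ t` (the ring hom `MvPolynomial.map (Polynomial.evalRingHom t)`, applied
entrywise) commutes with products of letters and with taking the `(0,0)` entry, coefficientwise: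
`coeff mono ((Πₘ φₜ(m)) 0 0) = (coeff mono ((Πₘ m) 0 0))(t)`. -/
theorem evalSum_coeff_eval_prod {σ : Type} (t : ℂ)
    (ms : List (Matrix (Fin 2) (Fin 2) (MvPolynomial σ (Polynomial ℂ)))) (mono : σ →₀ ℕ) :
    MvPolynomial.coeff mono ((ms.map (fun m =>
      (MvPolynomial.map (Polynomial.evalRingHom t)).mapMatrix m)).prod 0 0) =
      Polynomial.eval t (MvPolynomial.coeff mono (ms.prod 0 0)) := by
  have h : (ms.map (fun m => (MvPolynomial.map (Polynomial.evalRingHom t)).mapMatrix m)).prod =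
      (MvPolynomial.map (Polynomial.evalRingHom t)).mapMatrix ms.prod :=
    (map_list_prod (MvPolynomial.map (Polynomial.evalRingHom t)).mapMatrix ms).symm
  rw [h, RingHom.mapMatrix_apply, Matrix.map_apply, MvPolynomial.coeff_map,
    Polynomial.coe_evalRingHom]

/-- **stub_evalSum** (de-bordering, step 3): if the letters' coefficients have `ε`-degree `≤ q`,
the `(0,0)` entry `F` of a product of `≤ L` letters has `ε`-degree `≤ L q ≤ D`, and with moment
weights `Σᵢ cᵢ xᵢ^k = [k = q]` (`k ≤ D`) the border equation `F = ε^q f + ε^(q+1) G` gives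
`f = coeff_{ε^q} F = Σᵢ cᵢ · F(εᵢ)`, where `F(εᵢ)` is the `(0,0)` entry of the product of the
evaluated letters. [folklore] -/
theorem stub_evalSum {σ : Type} (q L D : ℕ) (f : MvPolynomial σ ℂ)
    (ms : List (Matrix (Fin 2) (Fin 2) (MvPolynomial σ (Polynomial ℂ))))
    (hlen : ms.length ≤ L) (hD : L * q ≤ D) (hqD : q ≤ D)
    (hS : ∀ m ∈ ms, ∀ i j : Fin 2,
      (∃ b : Polynomial ℂ, b.natDegree ≤ q ∧ m i j = MvPolynomial.C b) ∨
      (∃ (a b : Polynomial ℂ) (v : σ), a.natDegree ≤ q ∧ b.natDegree ≤ q ∧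
        m i j = MvPolynomial.C a * MvPolynomial.X v + MvPolynomial.C b))
    (hF : ∃ G : MvPolynomial σ (Polynomial ℂ), ms.prod 0 0 =
      MvPolynomial.C (Polynomial.X ^ q) * MvPolynomial.map Polynomial.C f +
        MvPolynomial.C (Polynomial.X ^ (q + 1)) * G)
    {N : ℕ} (x c : Fin N → ℂ)
    (hxc : ∀ k ≤ D, (∑ i, c i * x i ^ k) = if k = q then 1 else 0) :
    f = ∑ i, c i • (ms.map (fun m =>
      (MvPolynomial.map (Polynomial.evalRingHom (x i))).mapMatrix m)).prod 0 0 := by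
  classical
  obtain ⟨G, hG⟩ := hF
  -- (1) degree bookkeeping: every `x̄`-coefficient of `F = ms.prod 0 0` has `ε`-degree `≤ D`
  have hdeg : ∀ mono, (MvPolynomial.coeff mono (ms.prod 0 0)).natDegree ≤ D := by
    intro mono
    calc (MvPolynomial.coeff mono (ms.prod 0 0)).natDegree
        ≤ ms.length * q := evalSum_natDegree_coeff_prod q ms
            (fun m hm i j => evalSum_natDegree_coeff_letter (hS m hm i j)) 0 0 mono
      _ ≤ L * q := Nat.mul_le_mul_right q hlen
      _ ≤ D := hD
  -- (2) the border equation identifies `coeff mono f` with the `q`-th `ε`-coefficient of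
  -- `coeff mono F`
  have hq : ∀ mono, (MvPolynomial.coeff mono (ms.prod 0 0)).coeff q =
      MvPolynomial.coeff mono f := by
    intro mono
    rw [hG, MvPolynomial.coeff_add, MvPolynomial.coeff_C_mul, MvPolynomial.coeff_C_mul,
      MvPolynomial.coeff_map, Polynomial.coeff_add, Polynomial.coeff_X_pow_mul',
      Polynomial.coeff_X_pow_mul', if_pos le_rfl, if_neg (show ¬ (q + 1 ≤ q) by omega),
      Nat.sub_self, Polynomial.coeff_C_zero, add_zero]
  -- (3) the identity, coefficientwise
  refine MvPolynomial.ext _ _ (fun mono => ?_)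
  rw [← hq mono, MvPolynomial.coeff_sum]
  simp only [MvPolynomial.coeff_smul, smul_eq_mul, evalSum_coeff_eval_prod]
  set P := MvPolynomial.coeff mono (ms.prod 0 0)
  have hPdeg : P.natDegree < D + 1 := Nat.lt_succ_of_le (hdeg mono)
  symm
  calc ∑ i, c i * Polynomial.eval (x i) P
      = ∑ i, ∑ k ∈ Finset.range (D + 1), P.coeff k * (c i * x i ^ k) := by
        refine Finset.sum_congr rfl (fun i _ => ?_)
        rw [Polynomial.eval_eq_sum_range' hPdeg, Finset.mul_sum]
        refine Finset.sum_congr rfl (fun k _ => ?_)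
        ring
    _ = ∑ k ∈ Finset.range (D + 1), P.coeff k * ∑ i, c i * x i ^ k := by
        rw [Finset.sum_comm]
        refine Finset.sum_congr rfl (fun k _ => ?_)
        rw [Finset.mul_sum]
    _ = ∑ k ∈ Finset.range (D + 1), (if k = q then P.coeff k else 0) := by
        refine Finset.sum_congr rfl (fun k hk => ?_)
        rw [hxc k (Nat.lt_succ_iff.mp (Finset.mem_range.mp hk))]
        split_ifs
        · rw [mul_one]
        · rw [mul_zero]
    _ = P.coeff q := by
        rw [Finset.sum_ite_eq', if_pos (Finset.mem_range.mpr (Nat.lt_succ_of_le hqD))]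

end Summit.ValiantsHypothesis.ValiantsHypothesis.Cruxes.WordLengthQP.EpsOrderLadder
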